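import Mathlib
import Literature.Geometry.Symplectic.JHolomorphicMap
import Summits.SmoothPoincare4.SmoothPoincare4.Theorems.SullivanDualTameOrBrodyR4PencilDefs
import Summits.SmoothPoincare4.SmoothPoincare4.Theorems.SullivanDualTameOrBrodyR4ContinuityEstimates
import Summits.SmoothPoincare4.SmoothPoincare4.Theorems.SullivanDualTameOrBrodyR4ContinuityClosedness

/-!
# The continuity method for the anchored pencil (crux `TameOrBrodyR4`, stmt-SmoothPoincare4-7826, line `Sketch`, skeleton v8 §3 — lead prover file)

The lead's registered stub `stub_continuity` of the line skeleton, PROVED over the two deep inputs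
of the line (vocabulary `Theorems/SullivanDualTameOrBrodyR4PencilDefs.lean`): for `J` of class
`C^∞` with `J² = -1`, standard on `‖x‖ ≥ R` in a coordinate frame `(P, Q)`, assuming
`HasLocalFamilies J R P Q` (automatic transversality with the point constraint at infinity),
`HasUniqueDisjointMembers J R P Q` and `HasEmbeddedLimits J R P Q` (positivity of intersections,
adjunction) — EITHER the complete pencil in direction `P` exists as an evaluation map
`F : ℂ → ℂ → ℝ⁴`, jointly `C^∞`, bijective, with bijective differential, `F b` the member with
asymptotic value `b`, honest for `|b| ≥ 3R` — OR blow-up data.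

Proof (`Continuity.continuity_method`): if blow-up data exist we are done; otherwise the moduli set
`U = {b | ∃ member}` contains `{|b| ≥ 2R}` (flat planes, `helper_memberFlat`), is closed
(`helper_closedOrBlowup`, blow-up excluded) and open (`HasLocalFamilies`), hence `U = ℂ`; `F b :=`
the member with value `b`, unique by `HasUniqueDisjointMembers`, so `F` agrees near every `b₀` with
the jointly smooth local family through `F b₀`: `F` is jointly `C^∞` and its differential
`(β, ζ) ↦ ∂_b F β + ∂_ξ F ζ` is injective (parameter derivative nowhere tangent + immersed members),
hence bijective (`4 = 4`); `F` is injective (disjoint members, injective members) with open image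
(inverse function theorem) and closed image (a preimage sequence is bounded by the uniform
normalisation `helper_memberEstimates` and honesty, and `F` is continuous), hence onto `ℝ⁴`; far
members are the flat planes by uniqueness.

References: M. Gromov, Invent. Math. 82 (1985), §2.4.A; D. McDuff, JAMS 3 (1990), §3;
C. Wendl, *Holomorphic Curves in Low Dimensions* (2018), Thm 6.8.
-/

-- the registered namespace `Summit.SmoothPoincare4.SmoothPoincare4.…` repeats a component
set_option linter.dupNamespace false

noncomputable section

open scoped ContDiff Topology
open Filter Set Metric Literature.Geometry.Symplectic

namespace Summit.SmoothPoincare4.SmoothPoincare4.Cruxes.TameOrBrodyR4.Sketch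

/-- Local notation for the model space `ℝ⁴ = EuclideanSpace ℝ (Fin 4)`. -/
local notation "E4" => EuclideanSpace ℝ (Fin 4)

namespace Continuity

/-- `finrank ℝ (ℂ × ℂ) = finrank ℝ ℝ⁴`. -/
theorem finrank_prod_complex_eq : Module.finrank ℝ (ℂ × ℂ) = Module.finrank ℝ E4 := by
  simp [Module.finrank_prod, Complex.finrank_real_complex, finrank_euclideanSpace]

/-- **The continuity method (the lead's stub `stub_continuity`, proved over the deep inputs and
the classical stubs).** -/
theorem continuity_method (J : E4 → E4 →L[ℝ] E4) (R : ℝ) (P Q : E4 →L[ℝ] ℂ) (eP eQ : ℂ →L[ℝ] E4)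
    (hR : 0 < R) (hJs : ContDiff ℝ ∞ J) (hJ2 : ∀ x v, J x (J x v) = -v)
    (hPQ : IsCoordFrame P Q eP eQ)
    (hJP : ∀ x : E4, R ≤ ‖x‖ → ∀ v, P (J x v) = Complex.I * P v)
    (hJQ : ∀ x : E4, R ≤ ‖x‖ → ∀ v, Q (J x v) = Complex.I * Q v)
    (hLF : HasLocalFamilies J R P Q) (hUD : HasUniqueDisjointMembers J R P Q)
    (hEL : HasEmbeddedLimits J R P Q) :
    (∃ F : ℂ → ℂ → E4,
      ContDiff ℝ ∞ (fun p : ℂ × ℂ => F p.1 p.2) ∧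
      Function.Bijective (fun p : ℂ × ℂ => F p.1 p.2) ∧
      (∀ p : ℂ × ℂ, Function.Bijective (fderiv ℝ (fun p : ℂ × ℂ => F p.1 p.2) p)) ∧
      (∀ b, IsPencilMember J R P Q b (F b)) ∧
      (∀ b : ℂ, 3 * R ≤ ‖b‖ → ∀ ξ, Q (F b ξ) = b) ∧
      (∀ x : E4, 3 * R ≤ ‖Q x‖ → ∃ ξ, F (Q x) ξ = x)) ∨
    (∃ (K : Set E4) (f : ℕ → ℂ → E4), IsCompact K ∧ (∀ n, ContDiff ℝ ∞ (f n)) ∧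
      (∀ n, IsJHolomorphicFlat J (f n)) ∧ (∀ n (z : ℂ), ‖z‖ ≤ 1 → f n z ∈ K) ∧
      Tendsto (fun n => ‖fderiv ℝ (f n) 0‖) atTop atTop) := by
  classical
  by_cases hblow : ∃ (K : Set E4) (f : ℕ → ℂ → E4), IsCompact K ∧ (∀ n, ContDiff ℝ ∞ (f n)) ∧
      (∀ n, IsJHolomorphicFlat J (f n)) ∧ (∀ n (z : ℂ), ‖z‖ ≤ 1 → f n z ∈ K) ∧
      Tendsto (fun n => ‖fderiv ℝ (f n) 0‖) atTop atTop
  · exact Or.inr hblow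
  left
  obtain ⟨hpy, hPeP, hQeP, hPeQ, hQeQ, hsum⟩ := id hPQ
  -- the moduli set of realised asymptotic values
  set U : Set ℂ := {b | ∃ u, IsPencilMember J R P Q b u} with hU
  have hflat : ∀ b : ℂ, 2 * R ≤ ‖b‖ → IsPencilMember J R P Q b (fun ξ => eP ξ + eQ b) :=
    helper_memberFlat J R P Q eP eQ hR hPQ hJP hJQ
  have hfar : ∀ b : ℂ, 2 * R ≤ ‖b‖ → b ∈ U := fun b hb => ⟨_, hflat b hb⟩
  -- closed (closedness modulo blow-up, blow-up being excluded)
  have hclosed : IsClosed U := by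
    refine IsSeqClosed.isClosed fun b bs hbU hbs => ?_
    by_cases hbs2 : 2 * R ≤ ‖bs‖
    · exact hfar bs hbs2
    push Not at hbs2
    have hev : ∀ᶠ n in atTop, ‖b n‖ < 2 * R := hbs.norm.eventually (gt_mem_nhds hbs2)
    obtain ⟨N, hN⟩ := eventually_atTop.mp hev
    choose u hu using hbU
    rcases helper_closedOrBlowup J R P Q eP eQ hR hJs hJ2 hPQ hJP hJQ hEL (fun n => b (n + N))
        (fun n => u (n + N)) bs (fun n => hu _) (fun n => hN _ (Nat.le_add_left N n))
        ((tendsto_add_atTop_iff_nat N).mpr hbs) with ⟨v, hv⟩ | hbl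
    · exact ⟨v, hv⟩
    · exact absurd hbl hblow
  -- open (local families)
  have hopen : IsOpen U := by
    rw [Metric.isOpen_iff]
    rintro b₀ ⟨u₀, hu₀⟩
    obtain ⟨ε, hε, Φ, -, -, hΦm, -⟩ := hLF b₀ u₀ hu₀
    exact ⟨ε, hε, fun b hb => ⟨Φ b, hΦm b hb⟩⟩
  -- hence everything
  have h2Rmem : ((2 * R : ℝ) : ℂ) ∈ U :=
    hfar _ (by rw [Complex.norm_real, Real.norm_of_nonneg (by positivity)])
  have hUu : U = univ := IsClopen.eq_univ ⟨hclosed, hopen⟩ ⟨_, h2Rmem⟩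
  have hall : ∀ b : ℂ, ∃ u, IsPencilMember J R P Q b u := fun b => by
    have hb : b ∈ U := by rw [hUu]; exact mem_univ b
    exact hb
  choose F hF using hall
  have huniq : ∀ b u, IsPencilMember J R P Q b u → u = F b := fun b u hu =>
    (hUD b b u (F b) hu (hF b)).1 rfl
  have hflatF : ∀ b : ℂ, 2 * R ≤ ‖b‖ → F b = fun ξ => eP ξ + eQ b := fun b hb =>
    (huniq b _ (hflat b hb)).symm
  -- local agreement with the smooth local families
  have hlocal : ∀ b₀ : ℂ, ∃ ε > 0, ∃ Φ : ℂ → ℂ → E4,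
      ContDiffOn ℝ ∞ (fun p : ℂ × ℂ => Φ p.1 p.2) (ball b₀ ε ×ˢ univ) ∧
      (∀ b ∈ ball b₀ ε, Φ b = F b) ∧
      (∀ b ∈ ball b₀ ε, ∀ ξ β ζ : ℂ,
        fderiv ℝ (fun b' => Φ b' ξ) b β = fderiv ℝ (Φ b) ξ ζ → β = 0) := fun b₀ => by
    obtain ⟨ε, hε, Φ, hΦs, -, hΦm, hΦt⟩ := hLF b₀ (F b₀) (hF b₀)
    exact ⟨ε, hε, Φ, hΦs, fun b hb => huniq b _ (hΦm b hb), hΦt⟩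
  set Fu : ℂ × ℂ → E4 := fun p => F p.1 p.2 with hFu
  -- (F1) joint smoothness
  have hF1 : ContDiff ℝ ∞ Fu := by
    rw [contDiff_iff_contDiffAt]
    rintro ⟨b₀, ξ₀⟩
    obtain ⟨ε, hε, Φ, hΦs, hΦF, -⟩ := hlocal b₀
    have hnhds : ball b₀ ε ×ˢ (univ : Set ℂ) ∈ 𝓝 (b₀, ξ₀) :=
      prod_mem_nhds (ball_mem_nhds b₀ hε) univ_mem
    have h1 : ContDiffAt ℝ ∞ (fun p : ℂ × ℂ => Φ p.1 p.2) (b₀, ξ₀) :=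
      hΦs.contDiffAt hnhds
    refine h1.congr_of_eventuallyEq ?_
    filter_upwards [hnhds] with p hp
    show F p.1 p.2 = Φ p.1 p.2
    rw [hΦF p.1 hp.1]
  have hdiff : ∀ p, DifferentiableAt ℝ Fu p := fun p => hF1.contDiffAt.differentiableAt (by simp)
  -- partial derivatives of the uncurried map
  have hpb : ∀ (b₀ ξ₀ β : ℂ), fderiv ℝ Fu (b₀, ξ₀) (β, 0) = fderiv ℝ (fun b' => F b' ξ₀) b₀ β := by
    intro b₀ ξ₀ β
    have hc : HasFDerivAt (fun b' : ℂ => (b', ξ₀)) (ContinuousLinearMap.inl ℝ ℂ ℂ) b₀ :=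
      hasFDerivAt_prodMk_left b₀ ξ₀
    have hcomp := (hdiff (b₀, ξ₀)).hasFDerivAt.comp b₀ hc
    rw [show (fun b' => F b' ξ₀) = Fu ∘ fun b' => (b', ξ₀) from rfl, hcomp.fderiv]
    rfl
  have hpξ : ∀ (b₀ ξ₀ ζ : ℂ), fderiv ℝ Fu (b₀, ξ₀) (0, ζ) = fderiv ℝ (F b₀) ξ₀ ζ := by
    intro b₀ ξ₀ ζ
    have hc : HasFDerivAt (fun ξ : ℂ => (b₀, ξ)) (ContinuousLinearMap.inr ℝ ℂ ℂ) ξ₀ :=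
      hasFDerivAt_prodMk_right b₀ ξ₀
    have hcomp := (hdiff (b₀, ξ₀)).hasFDerivAt.comp ξ₀ hc
    rw [show F b₀ = Fu ∘ fun ξ => (b₀, ξ) from rfl, hcomp.fderiv]
    rfl
  -- (F3) bijective differential
  have hF3 : ∀ p : ℂ × ℂ, Function.Bijective (fderiv ℝ Fu p) := by
    rintro ⟨b₀, ξ₀⟩
    obtain ⟨ε, hε, Φ, -, hΦF, hΦt⟩ := hlocal b₀
    have hΦb : fderiv ℝ (fun b' => Φ b' ξ₀) b₀ = fderiv ℝ (fun b' => F b' ξ₀) b₀ :=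
      Filter.EventuallyEq.fderiv_eq (by
        filter_upwards [ball_mem_nhds b₀ hε] with b' hb'
        rw [hΦF b' hb'])
    have hinj : Function.Injective (fderiv ℝ Fu (b₀, ξ₀)) := by
      rw [injective_iff_map_eq_zero]
      rintro ⟨β, ζ⟩ h0
      have hsplit : fderiv ℝ Fu (b₀, ξ₀) (β, ζ) =
          fderiv ℝ (fun b' => F b' ξ₀) b₀ β + fderiv ℝ (F b₀) ξ₀ ζ := by
        rw [← hpb, ← hpξ, ← map_add, Prod.mk_add_mk, add_zero, zero_add]
      rw [hsplit] at h0
      have hβ : β = 0 := hΦt b₀ (mem_ball_self hε) ξ₀ β (-ζ) (by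
        rw [hΦb, hΦF b₀ (mem_ball_self hε), map_neg, eq_neg_iff_add_eq_zero, h0])
      subst hβ
      have hz : fderiv ℝ (F b₀) ξ₀ ζ = 0 := by simpa using h0
      have hζ : ζ = 0 := (hF b₀).2.2.2.1 ξ₀ (by rw [hz, map_zero])
      rw [hζ]
      rfl
    refine ⟨hinj, ?_⟩
    exact (LinearMap.injective_iff_surjective_of_finrank_eq_finrank
      (f := (fderiv ℝ Fu (b₀, ξ₀) : ℂ × ℂ →ₗ[ℝ] E4)) finrank_prod_complex_eq).mp hinj
  -- (F2) injective
  have hFinj : Function.Injective Fu := by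
    rintro ⟨b, ξ⟩ ⟨b', ξ'⟩ h
    have h' : F b ξ = F b' ξ' := h
    have hbb : b = b' := by
      by_contra hne
      exact (hUD b b' (F b) (F b') (hF b) (hF b')).2 hne ξ ξ' h'
    subst hbb
    rw [(hF b).2.2.1 h']
  -- (F2) surjective: the image is open and closed
  have hSopen : IsOpen (range Fu) := by
    rw [isOpen_iff_mem_nhds]
    rintro _ ⟨p, rfl⟩
    obtain ⟨hi, hs⟩ := hF3 p
    set L : (ℂ × ℂ) ≃L[ℝ] E4 := ContinuousLinearEquiv.ofBijective (fderiv ℝ Fu p)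
      (LinearMap.ker_eq_bot.mpr hi) (LinearMap.range_eq_top.mpr hs) with hL
    have hstrict : HasStrictFDerivAt Fu (L : ℂ × ℂ →L[ℝ] E4) p := by
      rw [hL, ContinuousLinearEquiv.coe_ofBijective]
      exact hF1.contDiffAt.hasStrictFDerivAt (by simp)
    rw [← hstrict.map_nhds_eq_of_equiv, Filter.mem_map]
    exact Filter.univ_mem' fun x => mem_range_self x
  have hSclosed : IsClosed (range Fu) := by
    refine IsSeqClosed.isClosed fun x xs hxS hxs => ?_
    choose p hp using hxS
    obtain ⟨Cx, hCx⟩ : ∃ C : ℝ, ∀ n, ‖x n‖ ≤ C := by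
      obtain ⟨C, hC⟩ := (Metric.isBounded_range_of_tendsto x hxs).exists_norm_le
      exact ⟨C, fun n => hC _ (mem_range_self n)⟩
    have hb_bd : ∀ n, ‖(p n).1‖ ≤ max (2 * R) Cx := fun n => by
      by_cases h : 2 * R ≤ ‖(p n).1‖
      · have hQ : Q (x n) = (p n).1 := by
          rw [← hp n]
          show Q (F (p n).1 (p n).2) = (p n).1
          rw [hflatF _ h]
          show Q (eP (p n).2 + eQ (p n).1) = (p n).1
          rw [map_add, hQeP, hQeQ, zero_add]
        calc ‖(p n).1‖ = ‖Q (x n)‖ := by rw [hQ]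
          _ ≤ ‖x n‖ := PencilDefs.norm_Q_le hPQ _
          _ ≤ Cx := hCx n
          _ ≤ max (2 * R) Cx := le_max_right _ _
      · exact (not_le.mp h).le.trans (le_max_left _ _)
    have hξ_bd : ∀ n, ‖(p n).2‖ ≤ max (6 * R) (Cx + 20 * R) := fun n => by
      by_cases h : 2 * R ≤ ‖(p n).1‖
      · have hPx : P (x n) = (p n).2 := by
          rw [← hp n]
          show P (F (p n).1 (p n).2) = (p n).2
          rw [hflatF _ h]
          show P (eP (p n).2 + eQ (p n).1) = (p n).2
          rw [map_add, hPeP, hPeQ, add_zero]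
        calc ‖(p n).2‖ = ‖P (x n)‖ := by rw [hPx]
          _ ≤ ‖x n‖ := PencilDefs.norm_P_le hPQ _
          _ ≤ Cx := hCx n
          _ ≤ Cx + 20 * R := by linarith
          _ ≤ max (6 * R) (Cx + 20 * R) := le_max_right _ _
      · push Not at h
        by_cases h6 : 6 * R ≤ ‖(p n).2‖
        · have hest := (helper_memberEstimates J R P Q eP eQ hR hPQ hJP hJQ (hF (p n).1) h).2.2.2.1
            (p n).2 h6
          have hPx : P (x n) = P (F (p n).1 (p n).2) := by rw [← hp n]
          have hpos : 0 < ‖(p n).2‖ := by linarith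
          have h120 : 120 * R ^ 2 / ‖(p n).2‖ ≤ 20 * R := by
            rw [div_le_iff₀ hpos]; nlinarith
          have htri : ‖(p n).2‖ ≤ ‖P (F (p n).1 (p n).2)‖ + ‖P (F (p n).1 (p n).2) - (p n).2‖ := by
            have := norm_sub_le (P (F (p n).1 (p n).2)) (P (F (p n).1 (p n).2) - (p n).2)
            rwa [sub_sub_cancel] at this
          calc ‖(p n).2‖ ≤ ‖P (F (p n).1 (p n).2)‖ + ‖P (F (p n).1 (p n).2) - (p n).2‖ := htri
            _ ≤ ‖x n‖ + 20 * R :=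
                add_le_add (by rw [← hPx]; exact PencilDefs.norm_P_le hPQ _) (hest.trans h120)
            _ ≤ Cx + 20 * R := by linarith [hCx n]
            _ ≤ max (6 * R) (Cx + 20 * R) := le_max_right _ _
        · exact (not_le.mp h6).le.trans (le_max_left _ _)
    have hmem : ∀ n, p n ∈ closedBall (0 : ℂ) (max (2 * R) Cx) ×ˢ closedBall (0 : ℂ) (max (6 * R) (Cx + 20 * R)) :=
      fun n => ⟨mem_closedBall_zero_iff.mpr (hb_bd n), mem_closedBall_zero_iff.mpr (hξ_bd n)⟩
    obtain ⟨q, -, ψ, hψ, hlimq⟩ :=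
      ((isCompact_closedBall _ _).prod (isCompact_closedBall _ _)).tendsto_subseq hmem
    have h1 : Tendsto (fun n => Fu (p (ψ n))) atTop (𝓝 (Fu q)) :=
      (hF1.continuous.tendsto q).comp hlimq
    have h2 : Tendsto (fun n => Fu (p (ψ n))) atTop (𝓝 xs) := by
      have : (fun n => Fu (p (ψ n))) = fun n => x (ψ n) := funext fun n => hp (ψ n)
      rw [this]
      exact hxs.comp hψ.tendsto_atTop
    exact ⟨q, tendsto_nhds_unique h1 h2⟩
  have hSuniv : range Fu = univ :=
    IsClopen.eq_univ ⟨hSclosed, hSopen⟩ (range_nonempty _)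
  have hFsurj : Function.Surjective Fu := fun x => by
    have hx : x ∈ range Fu := by rw [hSuniv]; exact mem_univ x
    exact hx
  refine ⟨F, hF1, ⟨hFinj, hFsurj⟩, hF3, hF, fun b hb ξ => ?_, fun x hx => ?_⟩
  · -- (F5) honest far members
    rw [hflatF b (by linarith)]
    show Q (eP ξ + eQ b) = b
    rw [map_add, hQeP, hQeQ, zero_add]
  · -- (F5') onto the far planes
    refine ⟨P x, ?_⟩
    rw [hflatF (Q x) (by linarith)]
    show eP (P x) + eQ (Q x) = x
    exact hsum x

end Continuity

/-- **The lead's registered stub `stub_continuity`: the continuity method**, proved over the deep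
inputs `HasLocalFamilies`, `HasUniqueDisjointMembers`, `HasEmbeddedLimits` and the landed classical
stubs. -/
theorem stub_continuity (J : E4 → E4 →L[ℝ] E4) (R : ℝ) (P Q : E4 →L[ℝ] ℂ) (eP eQ : ℂ →L[ℝ] E4)
    (hR : 0 < R) (hJs : ContDiff ℝ ∞ J) (hJ2 : ∀ x v, J x (J x v) = -v)
    (hPQ : IsCoordFrame P Q eP eQ)
    (hJP : ∀ x : E4, R ≤ ‖x‖ → ∀ v, P (J x v) = Complex.I * P v)
    (hJQ : ∀ x : E4, R ≤ ‖x‖ → ∀ v, Q (J x v) = Complex.I * Q v)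
    (hLF : HasLocalFamilies J R P Q) (hUD : HasUniqueDisjointMembers J R P Q)
    (hEL : HasEmbeddedLimits J R P Q) :
    (∃ F : ℂ → ℂ → E4,
      ContDiff ℝ ∞ (fun p : ℂ × ℂ => F p.1 p.2) ∧
      Function.Bijective (fun p : ℂ × ℂ => F p.1 p.2) ∧
      (∀ p : ℂ × ℂ, Function.Bijective (fderiv ℝ (fun p : ℂ × ℂ => F p.1 p.2) p)) ∧
      (∀ b, IsPencilMember J R P Q b (F b)) ∧
      (∀ b : ℂ, 3 * R ≤ ‖b‖ → ∀ ξ, Q (F b ξ) = b) ∧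
      (∀ x : E4, 3 * R ≤ ‖Q x‖ → ∃ ξ, F (Q x) ξ = x)) ∨
    (∃ (K : Set E4) (f : ℕ → ℂ → E4), IsCompact K ∧ (∀ n, ContDiff ℝ ∞ (f n)) ∧
      (∀ n, IsJHolomorphicFlat J (f n)) ∧ (∀ n (z : ℂ), ‖z‖ ≤ 1 → f n z ∈ K) ∧
      Tendsto (fun n => ‖fderiv ℝ (f n) 0‖) atTop atTop) :=
  Continuity.continuity_method J R P Q eP eQ hR hJs hJ2 hPQ hJP hJQ hLF hUD hEL

end Summit.SmoothPoincare4.SmoothPoincare4.Cruxes.TameOrBrodyR4.Sketch
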